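import Summits.ValiantsHypothesis.ValiantsHypothesis.Theorems.LacunarySymmetroidMatrixDescartesWLawTwoSixTools
import Summits.ValiantsHypothesis.ValiantsHypothesis.Theorems.LacunarySymmetroidMatrixDescartesWLawTwoChambers

/-!
# `MatrixDescartes` (stmt-ValiantsHypothesis-18050) — THE W-LAW AT `n = 2` IS `6`: `WLawAt 2 6`
# (the chamber `a < g < c < a + g` decided by a twist chain with one magnitude lever)

HONEST FRAMING.  Cell `pub-symmetroid`, seat `val-sym-mdr-p1` (gen 5); helper `--supports` the crux
`Theses.LacunarySymmetroid.MatrixDescartes` (OPEN, on HOLD), NO closure claim.  The typed candidate W-law of `…WLawDefs`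
(val-sym-mdr-p2 g4; `WLawAt n B`: every `n × n` W-configuration `X^e J + X^{d₁} P₁ + X^{d₂} P₂ + X^{d₃} Q`, `d₂ < d₁ < e < d₃`,
`J` symmetric, `P₁, P₂, Q ⪰ 0`, has at most `B` distinct positive zeros of its determinant; candidate `WLaw : ∀ n, WLawAt n (3n)`)
is PROVED here at its smallest open size: **`wLawAt_two_six : WLawAt 2 6`**, and with the tree witness
(`not_wLawAt_two_five`) **`wLawAt_two_iff_six_le : WLawAt 2 B ↔ 6 ≤ B`** — the `n = 2` W-constant is exactly `6 = 3n`.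
Seat g4 (`…WLawTwoChambers`) had proved `Z₊ ≤ 6` off the exponent chamber `e + d₂ < 2d₁ ∧ d₁ + e < d₂ + d₃ ∧ d₂ + d₃ < 2e`
(gap form `a < g < c < a + g`, `g = d₁ − d₂`, `a = e − d₁`, `c = d₃ − e`), where Descartes' rule allows `8`; this file
settles the chamber.  Nothing here bears on `WLaw` for `n ≥ 3`, on `MatrixDescartes` in its window, on `stub_twoSided`, on
`DoorA26` / `DoorA34`, on the cell's registers, or on `VP ≠ VNP`.

THE PROOF (`Z₊` counted WITH multiplicity throughout; `J` may be ANY real `2 × 2` matrix).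
1. `det F` is a ten-term fewnomial (`det_wPencil_eq`): coefficients `det P₂, mix(P₁,P₂), ·, det P₁, ·, mix(P₂,Q), ·,
   mix(P₁,Q), ·, det Q` at `2d₂ < d₁+d₂ < e+d₂ < 2d₁ < e+d₁ < d₂+d₃ < 2e < d₁+d₃ < e+d₃ < 2d₃` (chamber order), the dots
   being the four `J`-coefficients (arbitrary signs) and `mix(X,Y) = x₁₁y₂₂ + x₂₂y₁₁ − 2x₁₂y₁₂ ≥ 0` the mixed discriminant.
2. FIVE Euler twists `f ↦ X·f′ − E·f` at `E = e+d₂, e+d₁, 2e, e+d₃, 2d₃` kill the `J`-coefficients and `det Q`; each costs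
   at most one positive root, multiplicities included (tree `Census.countP_posRoots_le_countP_posRoots_twist_succ`), and
   multiplies the coefficient at degree `n` by `n − E`.  The surviving five-nomial `X^{2d₂}(α₀ + α₁X^g + α₂X^{2g} +
   α₃X^{g+a+c} + α₄X^{2g+a+c})` has signs `(≤0, ≤0, ≥0, ≤0, ≥0)` on the chamber (`fiveNomial_countP_posRoots_le_one`):
3. END-KILL (tree `…twist_of_endKill`): the two lowest coefficients have the same sign, so the sixth twist, at the constant
   term, costs NOTHING (when `α₀ = 0`, i.e. `det P₂ = 0`, it is not needed; when `α₀ < 0 = α₁` positivity of `det P₂`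
   forces `P₁ = 0` by `eq_zero_of_mix_nonpos` and the five-nomial has no positive root at all);
4. the final four-nomial `a₁X^g + a₂X^{2g} + a₃X^{g+a+c} + a₄X^{2g+a+c}` (`−,+,−,+`) satisfies `a₂|a₃| ≤ |a₁|a₄` — this is
   seat g4's LEVER `det(P₁)·mix(P₂,Q) ≤ mix(P₁,P₂)·mix(P₁,Q)` (kernel: `WLawTwoSix.lever`, the identity
   `mix(A,B)mix(A,Q) − det(A)mix(B,Q) = tr(adj A·B·adj A·Q)`) TIMES the exponent inequality `multiplier_ineq_six`
   (`8(g−a)(2a+c)(c−g)(a+g−c)(a+g+c)² ≤ (2g+a+c)(2a+g)(2a+g+c)(2a+2c+g)(g+c)(c−a)` on the whole chamber) — so by the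
   FOUR-NOMIAL LEMMA (`fourNomial_countP_posRoots_le_one`: `A − BX^g + X^q(C − DX^g)`, `BC ≤ AD` ⇒ positive, then
   strictly decreasing) it has at most ONE positive root.  Total: `Z₊ ≤ 5 + 0 + 1 = 6`.
Off the chamber: g4's `WLawTwoChambers.wLawTwo_posRoots_le_six_of_not_chamber`.  WHY THE LEVER: an order-8 contact of
`det F` (the local model of eight roots) is infeasible on every chamber triple and the binding obstruction on the whole
sign-feasible jet kernel is exactly this inequality (seat memo WLAW-N2-SIX.md, numerics only; not used by the kernel).

[folklore] Rolle / Descartes with multiplicity (Mathlib, tree `…CensusTwistedRolleMult`), mixed discriminants; no single source.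
-/

-- `Summit.ValiantsHypothesis.ValiantsHypothesis.…` repeats a component by the D-0017 layout
-- (single-conjunct summit), which the `dupNamespace` linter flags; the name is mandated.
set_option linter.dupNamespace false

namespace Summit.ValiantsHypothesis.ValiantsHypothesis.Theorems.LacunarySymmetroidMatrixDescartes

open Polynomial Finset
open scoped BigOperators Polynomial

namespace WLawTwoSix

/-! ### 1. The determinant of the `2 × 2` W-pencil, expanded -/

/-- The determinant of the `2 × 2` four-letter pencil as a sum of ten monomials (`J` arbitrary; `P₁, P₂, Q` symmetric):
squares give `det`, cross terms give mixed discriminants `x₁₁y₂₂ + x₂₂y₁₁ − 2x₁₂y₁₂`. [folklore] -/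
theorem det_wPencil_eq (e d₁ d₂ d₃ : ℕ) (J P₁ P₂ Q : Matrix (Fin 2) (Fin 2) ℝ)
    (hP₁ : P₁ 1 0 = P₁ 0 1) (hP₂ : P₂ 1 0 = P₂ 0 1) (hQ : Q 1 0 = Q 0 1) :
    Matrix.det (((X : ℝ[X]) ^ e) • J.map C + ((X : ℝ[X]) ^ d₁) • P₁.map C
        + ((X : ℝ[X]) ^ d₂) • P₂.map C + ((X : ℝ[X]) ^ d₃) • Q.map C)
      = C (P₂ 0 0 * P₂ 1 1 - P₂ 0 1 * P₂ 0 1) * X ^ (d₂ + d₂)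
        + C (P₁ 0 0 * P₂ 1 1 + P₁ 1 1 * P₂ 0 0 - 2 * (P₁ 0 1 * P₂ 0 1)) * X ^ (d₁ + d₂)
        + C (J 0 0 * P₂ 1 1 + J 1 1 * P₂ 0 0 - J 0 1 * P₂ 0 1 - J 1 0 * P₂ 0 1) * X ^ (e + d₂)
        + C (P₁ 0 0 * P₁ 1 1 - P₁ 0 1 * P₁ 0 1) * X ^ (d₁ + d₁)
        + C (J 0 0 * P₁ 1 1 + J 1 1 * P₁ 0 0 - J 0 1 * P₁ 0 1 - J 1 0 * P₁ 0 1) * X ^ (e + d₁)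
        + C (P₂ 0 0 * Q 1 1 + P₂ 1 1 * Q 0 0 - 2 * (P₂ 0 1 * Q 0 1)) * X ^ (d₂ + d₃)
        + C (J 0 0 * J 1 1 - J 0 1 * J 1 0) * X ^ (e + e)
        + C (P₁ 0 0 * Q 1 1 + P₁ 1 1 * Q 0 0 - 2 * (P₁ 0 1 * Q 0 1)) * X ^ (d₁ + d₃)
        + C (J 0 0 * Q 1 1 + J 1 1 * Q 0 0 - J 0 1 * Q 0 1 - J 1 0 * Q 0 1) * X ^ (e + d₃)
        + C (Q 0 0 * Q 1 1 - Q 0 1 * Q 0 1) * X ^ (d₃ + d₃) := by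
  rw [Matrix.det_fin_two]
  simp only [Matrix.add_apply, Matrix.smul_apply, Matrix.map_apply, smul_eq_mul, hP₁, hP₂, hQ,
    C_add, C_sub, C_mul, C_ofNat, pow_add]
  ring

/-! ### 2. The five-nomial endgame -/

/-- **Five-nomial endgame.**  The shifted five-nomial `α₀ + α₁ X^g + α₂ X^{2g} + α₃ X^{g+a+c} + α₄ X^{2g+a+c}` (`0 < g`,
`0 < a`, `g < c`) with signs `(≤0, ≤0, ≥0, ≤0, ≥0)`, the lever-type inequality `2g(g+a+c)·α₂|α₃| ≤ g(2g+a+c)·|α₁|α₄` and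
the degeneracy rule `α₀ < 0 ∧ α₁ = 0 ⇒ α₂ = α₄ = 0` has at most one positive root, multiplicities included: END-KILL at
the constant term (free when `α₀, α₁ < 0`; tree `Census.countP_posRoots_le_countP_posRoots_twist_of_endKill`), then the
four-nomial lemma; when `α₀ = 0` the four-nomial lemma directly. [folklore] -/
theorem fiveNomial_countP_posRoots_le_one (α₀ α₁ α₂ α₃ α₄ : ℝ) (g a c : ℕ) (hg : 0 < g) (ha : 0 < a) (hgc : g < c)
    (h₀ : α₀ ≤ 0) (h₁ : α₁ ≤ 0) (h₂ : 0 ≤ α₂) (h₃ : α₃ ≤ 0) (h₄ : 0 ≤ α₄)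
    (h6 : 2 * (g : ℝ) * (g + a + c) * (α₂ * -α₃) ≤ (g : ℝ) * (2 * g + a + c) * (-α₁ * α₄))
    (hdeg : α₀ < 0 → α₁ = 0 → α₂ = 0 ∧ α₄ = 0) :
    (C α₀ * X ^ 0 + C α₁ * X ^ g + C α₂ * X ^ (g + g) + C α₃ * X ^ (g + (a + c))
        + C α₄ * X ^ (g + (a + c) + g)).roots.countP (fun x => 0 < x) ≤ 1 := by
  have hg' : (0 : ℝ) < g := by exact_mod_cast hg
  have hX : 0 ≤ α₂ * -α₃ := mul_nonneg h₂ (by linarith)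
  have hY : 0 ≤ -α₁ * α₄ := mul_nonneg (by linarith) h₄
  by_cases hz₀ : α₀ = 0
  · -- no constant term: the four-nomial lemma directly
    subst hz₀
    have hform : C (0 : ℝ) * X ^ 0 + C α₁ * X ^ g + C α₂ * X ^ (g + g) + C α₃ * X ^ (g + (a + c))
          + C α₄ * X ^ (g + (a + c) + g)
        = -(C (-α₁) * X ^ g - C α₂ * X ^ (g + g) + C (-α₃) * X ^ (g + (a + c)) - C α₄ * X ^ (g + (a + c) + g)) := by
      simp only [map_zero, map_neg, zero_mul, zero_add]
      ring
    rw [hform, roots_neg]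
    refine fourNomial_countP_posRoots_le_one (-α₁) α₂ (-α₃) α₄ (by linarith) h₂ (by linarith) h₄ ?_ g g (a + c) hg
    -- `α₂ |α₃| ≤ |α₁| α₄` from `h6` and `g(2g+a+c) ≤ 2g(g+a+c)`
    have hcoef : (g : ℝ) * (2 * g + a + c) ≤ 2 * (g : ℝ) * (g + a + c) := by
      have : (0 : ℝ) ≤ a := Nat.cast_nonneg a
      have : (0 : ℝ) ≤ c := Nat.cast_nonneg c
      nlinarith
    have h7 : 2 * (g : ℝ) * (g + a + c) * (α₂ * -α₃) ≤ 2 * (g : ℝ) * (g + a + c) * (-α₁ * α₄) :=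
      h6.trans (mul_le_mul_of_nonneg_right hcoef hY)
    have hpos : (0 : ℝ) < 2 * (g : ℝ) * (g + a + c) := by positivity
    exact le_of_mul_le_mul_left h7 hpos
  · have hα₀ : α₀ < 0 := lt_of_le_of_ne h₀ hz₀
    by_cases hz₁ : α₁ = 0
    · -- degenerate: all coefficients `≤ 0`, no positive root at all
      obtain ⟨hz₂, hz₄⟩ := hdeg hα₀ hz₁
      subst hz₁; subst hz₂; subst hz₄
      have hnn : ∀ n, (C α₀ * X ^ 0 + C (0 : ℝ) * X ^ g + C (0 : ℝ) * X ^ (g + g) + C α₃ * X ^ (g + (a + c))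
          + C (0 : ℝ) * X ^ (g + (a + c) + g)).coeff n ≤ 0 := by
        intro n
        simp only [map_zero, zero_mul, add_zero, coeff_add, coeff_C_mul, coeff_X_pow]
        split_ifs <;> linarith
      have hV := Literature.Algebra.Polynomial.Descartes.signVariations_eq_zero_of_coeff_nonpos hnn
      have hD := (C α₀ * X ^ 0 + C (0 : ℝ) * X ^ g + C (0 : ℝ) * X ^ (g + g) + C α₃ * X ^ (g + (a + c))
          + C (0 : ℝ) * X ^ (g + (a + c) + g)).roots_countP_pos_le_signVariations
      omega
    · have hα₁ : α₁ < 0 := lt_of_le_of_ne h₁ hz₁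
      set ψ : ℝ[X] := C α₀ * X ^ 0 + C α₁ * X ^ g + C α₂ * X ^ (g + g) + C α₃ * X ^ (g + (a + c))
          + C α₄ * X ^ (g + (a + c) + g) with hψ
      -- coefficients of `ψ` below and at `g`
      have hcoeff : ∀ j, j < g → ψ.coeff j = if j = 0 then α₀ else 0 := by
        intro j hj
        simp only [hψ, coeff_add, coeff_C_mul, coeff_X_pow]
        have h1 : ¬ j = g := by omega
        have h2 : ¬ j = g + g := by omega
        have h3 : ¬ j = g + (a + c) := by omega
        have h4 : ¬ j = g + (a + c) + g := by omega
        simp only [h1, h2, h3, h4, if_false, mul_zero, add_zero]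
        split_ifs <;> ring
      have hcg : ψ.coeff g = α₁ := by
        simp only [hψ, coeff_add, coeff_C_mul, coeff_X_pow]
        simp [hg.ne', ha.ne']
      -- END-KILL at the constant term (free)
      have hek := Census.countP_posRoots_le_countP_posRoots_twist_of_endKill ψ (k := 0) (m := g) hg
        (fun j hj => absurd hj (Nat.not_lt_zero j))
        (fun j hj1 hj2 => by rw [hcoeff j (by omega), if_neg (by omega)])
        (by rw [zero_add, hcg, hcoeff 0 hg, if_pos rfl]; exact mul_pos_of_neg_of_neg hα₀ hα₁)
      -- the twisted polynomial is the four-nomial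
      have htw : X * derivative ψ - C ((0 : ℕ) : ℝ) * ψ
          = -(C (-α₁ * g) * X ^ g - C (α₂ * (2 * g)) * X ^ (g + g) + C (-α₃ * (g + a + c)) * X ^ (g + (a + c))
              - C (α₄ * (2 * g + a + c)) * X ^ (g + (a + c) + g)) := by
        simp only [hψ, twist_add, twist_C_mul_X_pow]
        simp only [C_mul, C_sub, C_neg, C_add, map_natCast, C_ofNat]
        push_cast
        ring
      rw [htw, roots_neg] at hek
      refine hek.trans (fourNomial_countP_posRoots_le_one _ _ _ _ (by nlinarith) (by positivity) ?_ (by positivity)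
        ?_ g g (a + c) hg)
      · have : (0 : ℝ) ≤ (g : ℝ) + a + c := by positivity
        nlinarith
      · have : -α₁ * g * (α₄ * (2 * g + a + c)) - α₂ * (2 * g) * (-α₃ * (g + a + c))
            = (g : ℝ) * (2 * g + a + c) * (-α₁ * α₄) - 2 * (g : ℝ) * (g + a + c) * (α₂ * -α₃) := by ring
        linarith

/-! ### 3. The chamber -/

/-- **`Z₊ ≤ 6` ON THE CHAMBER, gap form, multiplicities included.**  For `d₁ = d₂ + g`, `e = d₂ + g + a`,
`d₃ = d₂ + g + a + c` with `0 < a < g < c < a + g`, every `2 × 2` W-pencil (`J` ANY real `2 × 2` matrix, `P₁, P₂, Q ⪰ 0`)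
has at most six positive roots of its determinant, counted with multiplicity: five Euler twists, the free END-KILL, the
lever times `multiplier_ineq_six`, and the four-nomial lemma. [folklore] -/
theorem wLawTwo_countP_posRoots_le_six_gaps (d₂ g a c : ℕ) (J P₁ P₂ Q : Matrix (Fin 2) (Fin 2) ℝ)
    (hP₁ : P₁.PosSemidef) (hP₂ : P₂.PosSemidef) (hQ : Q.PosSemidef)
    (ha : 0 < a) (hag : a < g) (hgc : g < c) (hcag : c < a + g) :
    (Matrix.det (((X : ℝ[X]) ^ (d₂ + g + a)) • J.map C + ((X : ℝ[X]) ^ (d₂ + g)) • P₁.map C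
        + ((X : ℝ[X]) ^ d₂) • P₂.map C + ((X : ℝ[X]) ^ (d₂ + g + a + c)) • Q.map C)).roots.countP
      (fun x => 0 < x) ≤ 6 := by
  obtain ⟨ha₁, ha₃, ha₂, hadet⟩ := Pivot.TwoDescartes.psd_two_facts hP₁
  obtain ⟨hb₁, hb₃, hb₂, hbdet⟩ := Pivot.TwoDescartes.psd_two_facts hP₂
  obtain ⟨hq₁, hq₃, hq₂, hqdet⟩ := Pivot.TwoDescartes.psd_two_facts hQ
  have hg : 0 < g := lt_trans ha hag
  have hgR : (0 : ℝ) < g := by exact_mod_cast hg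
  have haR : (0 : ℝ) < a := by exact_mod_cast ha
  have hcR : (0 : ℝ) < c := by exact_mod_cast (lt_trans hg hgc)
  have hagR : (a : ℝ) < g := by exact_mod_cast hag
  have hgcR : (g : ℝ) < c := by exact_mod_cast hgc
  have hcagR : (c : ℝ) < a + g := by exact_mod_cast hcag
  set f := Matrix.det (((X : ℝ[X]) ^ (d₂ + g + a)) • J.map C + ((X : ℝ[X]) ^ (d₂ + g)) • P₁.map C
        + ((X : ℝ[X]) ^ d₂) • P₂.map C + ((X : ℝ[X]) ^ (d₂ + g + a + c)) • Q.map C) with hf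
  have hdet := det_wPencil_eq (d₂ + g + a) (d₂ + g) d₂ (d₂ + g + a + c) J P₁ P₂ Q ha₂ hb₂ hq₂
  rw [← hf] at hdet
  -- letter data
  set dB : ℝ := P₂ 0 0 * P₂ 1 1 - P₂ 0 1 * P₂ 0 1 with hdB
  set dA : ℝ := P₁ 0 0 * P₁ 1 1 - P₁ 0 1 * P₁ 0 1 with hdA
  set mAB : ℝ := P₁ 0 0 * P₂ 1 1 + P₁ 1 1 * P₂ 0 0 - 2 * (P₁ 0 1 * P₂ 0 1) with hmAB
  set mBQ : ℝ := P₂ 0 0 * Q 1 1 + P₂ 1 1 * Q 0 0 - 2 * (P₂ 0 1 * Q 0 1) with hmBQ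
  set mAQ : ℝ := P₁ 0 0 * Q 1 1 + P₁ 1 1 * Q 0 0 - 2 * (P₁ 0 1 * Q 0 1) with hmAQ
  have hdB0 : 0 ≤ dB := by rw [hdB]; linarith
  have hdA0 : 0 ≤ dA := by rw [hdA]; linarith
  have hmAB0 : 0 ≤ mAB := mix_nonneg' _ _ _ _ _ _ ha₁ ha₃ hadet hb₁ hb₃ hbdet
  have hmBQ0 : 0 ≤ mBQ := mix_nonneg' _ _ _ _ _ _ hb₁ hb₃ hbdet hq₁ hq₃ hqdet
  have hmAQ0 : 0 ≤ mAQ := mix_nonneg' _ _ _ _ _ _ ha₁ ha₃ hadet hq₁ hq₃ hqdet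
  -- multipliers (in gap units)
  set M₀ : ℝ := -(((g : ℝ) + a) * (2 * g + a) * (2 * g + 2 * a) * (2 * g + 2 * a + c) * (2 * g + 2 * a + 2 * c))
    with hM₀
  set M₁ : ℝ := -((a : ℝ) * (g + a) * (g + 2 * a) * (g + 2 * a + c) * (g + 2 * a + 2 * c)) with hM₁
  set M₂ : ℝ := ((g : ℝ) - a) * a * (2 * a) * (2 * a + c) * (2 * a + 2 * c) with hM₂
  set M₃ : ℝ := -((c : ℝ) * (c - g) * (g + a - c) * (g + a) * (g + a + c)) with hM₃
  set M₄ : ℝ := ((g : ℝ) + c) * c * (c - a) * a * (a + c) with hM₄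
  have hM₀neg : M₀ < 0 := by rw [hM₀]; exact neg_neg_of_pos (by positivity)
  have hM₁neg : M₁ < 0 := by rw [hM₁]; exact neg_neg_of_pos (by positivity)
  have hM₂pos : 0 < M₂ := by
    rw [hM₂]
    have : (0 : ℝ) < g - a := by linarith
    positivity
  have hM₃neg : M₃ < 0 := by
    rw [hM₃]
    have h1 : (0 : ℝ) < c - g := by linarith
    have h2 : (0 : ℝ) < g + a - c := by linarith
    exact neg_neg_of_pos (by positivity)
  have hM₄pos : 0 < M₄ := by
    rw [hM₄]
    have : (0 : ℝ) < c - a := by linarith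
    positivity
  -- the chain of five Euler twists at `e + d₂`, `e + d₁`, `2e`, `e + d₃`, `2d₃`
  set T₁ : ℝ[X] := X * derivative f - C ((d₂ + g + a + d₂ : ℕ) : ℝ) * f with hT₁
  set T₂ : ℝ[X] := X * derivative T₁ - C ((d₂ + g + a + (d₂ + g) : ℕ) : ℝ) * T₁ with hT₂
  set T₃ : ℝ[X] := X * derivative T₂ - C ((d₂ + g + a + (d₂ + g + a) : ℕ) : ℝ) * T₂ with hT₃
  set T₄ : ℝ[X] := X * derivative T₃ - C ((d₂ + g + a + (d₂ + g + a + c) : ℕ) : ℝ) * T₃ with hT₄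
  set T₅ : ℝ[X] := X * derivative T₄ - C ((d₂ + g + a + c + (d₂ + g + a + c) : ℕ) : ℝ) * T₄ with hT₅
  have s1 : f.roots.countP (fun x => 0 < x) ≤ T₁.roots.countP (fun x => 0 < x) + 1 :=
    Census.countP_posRoots_le_countP_posRoots_twist_succ f _
  have s2 : T₁.roots.countP (fun x => 0 < x) ≤ T₂.roots.countP (fun x => 0 < x) + 1 :=
    Census.countP_posRoots_le_countP_posRoots_twist_succ T₁ _
  have s3 : T₂.roots.countP (fun x => 0 < x) ≤ T₃.roots.countP (fun x => 0 < x) + 1 :=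
    Census.countP_posRoots_le_countP_posRoots_twist_succ T₂ _
  have s4 : T₃.roots.countP (fun x => 0 < x) ≤ T₄.roots.countP (fun x => 0 < x) + 1 :=
    Census.countP_posRoots_le_countP_posRoots_twist_succ T₃ _
  have s5 : T₄.roots.countP (fun x => 0 < x) ≤ T₅.roots.countP (fun x => 0 < x) + 1 :=
    Census.countP_posRoots_le_countP_posRoots_twist_succ T₄ _
  -- the five twists kill the `J`-coefficients and `det Q`
  have hψ : T₅ = X ^ (d₂ + d₂) * (C (dB * M₀) * X ^ 0 + C (mAB * M₁) * X ^ g + C (dA * M₂) * X ^ (g + g)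
          + C (mBQ * M₃) * X ^ (g + (a + c)) + C (mAQ * M₄) * X ^ (g + (a + c) + g)) := by
    rw [hT₅, hT₄, hT₃, hT₂, hT₁, hdet]
    simp only [twist_add, twist_C_mul_X_pow]
    simp only [hdB, hdA, hmAB, hmBQ, hmAQ, hM₀, hM₁, hM₂, hM₃, hM₄, C_mul, C_sub, C_add, C_neg, map_natCast,
      C_ofNat, pow_add, pow_zero]
    push_cast
    ring
  rw [hψ, Census.countP_posRoots_X_pow_mul] at s5
  -- the endgame
  have key := fiveNomial_countP_posRoots_le_one (dB * M₀) (mAB * M₁) (dA * M₂) (mBQ * M₃) (mAQ * M₄) g a c hg ha hgc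
    (mul_nonpos_iff.mpr (Or.inl ⟨hdB0, hM₀neg.le⟩)) (mul_nonpos_iff.mpr (Or.inl ⟨hmAB0, hM₁neg.le⟩))
    (mul_nonneg hdA0 hM₂pos.le) (mul_nonpos_iff.mpr (Or.inl ⟨hmBQ0, hM₃neg.le⟩)) (mul_nonneg hmAQ0 hM₄pos.le)
    ?_ ?_
  · omega
  · -- the lever times the exponent inequality
    have hlev : dA * mBQ ≤ mAB * mAQ :=
      lever (P₁ 0 0) (P₁ 0 1) (P₁ 1 1) (P₂ 0 0) (P₂ 0 1) (P₂ 1 1) (Q 0 0) (Q 0 1) (Q 1 1)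
        hb₁ hb₃ hbdet hq₁ hq₃ hqdet
    have hsix := multiplier_ineq_six (a : ℝ) g c haR hagR hgcR hcagR
    set W : ℝ := (g : ℝ) * a ^ 2 * (g + a) * c * (a + c) with hW
    have hW0 : 0 ≤ W := by positivity
    have hL0 : 0 ≤ 8 * ((g : ℝ) - a) * (2 * a + c) * (c - g) * (a + g - c) * (a + g + c) ^ 2 := by
      have h1 : (0 : ℝ) ≤ g - a := by linarith
      have h2 : (0 : ℝ) ≤ c - g := by linarith
      have h3 : (0 : ℝ) ≤ a + g - c := by linarith
      positivity
    have step := mul_le_mul hlev (mul_le_mul_of_nonneg_left hsix hW0) (mul_nonneg hW0 hL0) (mul_nonneg hmAB0 hmAQ0)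
    have eL : 2 * (g : ℝ) * (g + a + c) * (dA * M₂ * -(mBQ * M₃))
        = dA * mBQ * (W * (8 * ((g : ℝ) - a) * (2 * a + c) * (c - g) * (a + g - c) * (a + g + c) ^ 2)) := by
      rw [hM₂, hM₃, hW]; ring
    have eR : (g : ℝ) * (2 * g + a + c) * (-(mAB * M₁) * (mAQ * M₄))
        = mAB * mAQ * (W * ((2 * (g : ℝ) + a + c) * (2 * a + g) * (2 * a + g + c) * (2 * a + 2 * c + g) * (g + c)
            * (c - a))) := by
      rw [hM₁, hM₄, hW]; ring
    rw [eL, eR]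
    exact step
  · -- degeneracy: `det P₂ > 0` and `mix(P₁,P₂) = 0` force `P₁ = 0`
    intro h0 h1
    have hdBpos : 0 < dB := by
      by_contra hle
      have : dB = 0 := le_antisymm (not_lt.mp hle) hdB0
      rw [this, zero_mul] at h0
      exact lt_irrefl 0 h0
    have hmAB_zero : mAB = 0 := by
      rcases mul_eq_zero.mp h1 with h | h
      · exact h
      · exact absurd h hM₁neg.ne
    have hstrict : P₂ 0 1 * P₂ 0 1 < P₂ 0 0 * P₂ 1 1 := by rw [hdB] at hdBpos; linarith
    have hmix' : P₂ 0 0 * P₁ 1 1 + P₂ 1 1 * P₁ 0 0 - 2 * (P₂ 0 1 * P₁ 0 1) ≤ 0 := by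
      rw [hmAB] at hmAB_zero; linarith
    obtain ⟨e1, e2, e3⟩ := eq_zero_of_mix_nonpos _ _ _ _ _ _ hb₁ hstrict ha₁ ha₃ hadet hmix'
    refine ⟨?_, ?_⟩
    · rw [hdA, e1, e2]; ring
    · rw [hmAQ, e1, e2, e3]; ring

/-- **`Z₊ ≤ 6` ON THE CHAMBER `e + d₂ < 2d₁ ∧ d₁ + e < d₂ + d₃ ∧ d₂ + d₃ < 2e`** (gap form `a < g < c < a + g`), positive
roots counted with multiplicity; `J` is an arbitrary real `2 × 2` matrix, `P₁, P₂, Q ⪰ 0`. [folklore] -/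
theorem wLawTwo_countP_posRoots_le_six_of_chamber (e d₁ d₂ d₃ : ℕ) (J P₁ P₂ Q : Matrix (Fin 2) (Fin 2) ℝ)
    (hP₁ : P₁.PosSemidef) (hP₂ : P₂.PosSemidef) (hQ : Q.PosSemidef)
    (h₂₁ : d₂ < d₁) (h₁ₑ : d₁ < e) (hₑ₃ : e < d₃)
    (hch : e + d₂ < 2 * d₁ ∧ d₁ + e < d₂ + d₃ ∧ d₂ + d₃ < 2 * e) :
    (Matrix.det (((X : ℝ[X]) ^ e) • J.map C + ((X : ℝ[X]) ^ d₁) • P₁.map C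
        + ((X : ℝ[X]) ^ d₂) • P₂.map C + ((X : ℝ[X]) ^ d₃) • Q.map C)).roots.countP (fun x => 0 < x) ≤ 6 := by
  obtain ⟨g, rfl⟩ := Nat.exists_eq_add_of_le h₂₁.le
  obtain ⟨a, rfl⟩ := Nat.exists_eq_add_of_le h₁ₑ.le
  obtain ⟨c, rfl⟩ := Nat.exists_eq_add_of_le hₑ₃.le
  exact wLawTwo_countP_posRoots_le_six_gaps d₂ g a c J P₁ P₂ Q hP₁ hP₂ hQ (by omega) (by omega) (by omega)
    (by omega)

/-- **THE W-LAW AT `n = 2`: `Z₊ ≤ 6 = 3·2` for EVERY `2 × 2` W-configuration** (`d₂ < d₁ < e < d₃`, `J` any real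
`2 × 2` matrix, `P₁, P₂, Q ⪰ 0`), distinct positive roots: on the chamber by the twist chain above, off the chamber by
the clustered sign budgets of `WLawTwoChambers.wLawTwo_posRoots_le_six_of_not_chamber` (seat g4). [folklore] -/
theorem wLawTwo_posRoots_le_six (e d₁ d₂ d₃ : ℕ) (J P₁ P₂ Q : Matrix (Fin 2) (Fin 2) ℝ)
    (hP₁ : P₁.PosSemidef) (hP₂ : P₂.PosSemidef) (hQ : Q.PosSemidef)
    (h₂₁ : d₂ < d₁) (h₁ₑ : d₁ < e) (hₑ₃ : e < d₃) :
    ((Matrix.det (((X : ℝ[X]) ^ e) • J.map C + ((X : ℝ[X]) ^ d₁) • P₁.map C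
        + ((X : ℝ[X]) ^ d₂) • P₂.map C + ((X : ℝ[X]) ^ d₃) • Q.map C)).roots.toFinset.filter
          (fun t => 0 < t)).card ≤ 6 := by
  by_cases hch : e + d₂ < 2 * d₁ ∧ d₁ + e < d₂ + d₃ ∧ d₂ + d₃ < 2 * e
  · exact (Census.card_posRoots_le_countP_posRoots _).trans
      (wLawTwo_countP_posRoots_le_six_of_chamber e d₁ d₂ d₃ J P₁ P₂ Q hP₁ hP₂ hQ h₂₁ h₁ₑ hₑ₃ hch)
  · exact WLawTwoChambers.wLawTwo_posRoots_le_six_of_not_chamber hP₁ hP₂ hQ h₂₁ h₁ₑ hₑ₃ hch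

end WLawTwoSix

/-! ### 4. `WLawAt 2 6` and the exact `n = 2` constant -/

/-- **`WLawAt 2 6`** — the `n = 2` instance of the typed W-law `WLaw` (`…WLawDefs`, val-sym-mdr-p2 g4) holds with the
conjectured constant `3n = 6`: every `2 × 2` W-configuration has at most six distinct positive zeros of its determinant.
[folklore] -/
theorem wLawAt_two_six : WLawAt 2 6 :=
  fun e d₁ d₂ d₃ J P₁ P₂ Q _ hP₁ hP₂ hQ h₂₁ h₁ₑ hₑ₃ =>
    WLawTwoSix.wLawTwo_posRoots_le_six e d₁ d₂ d₃ J P₁ P₂ Q hP₁ hP₂ hQ h₂₁ h₁ₑ hₑ₃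

/-- **The `n = 2` constant of the W-law is exactly six**: `WLawAt 2 B ↔ 6 ≤ B` (upper half: `wLawAt_two_six`; lower
half: the tree witness `WLawTwoWitness` via `not_wLawAt_two_five`). [folklore] -/
theorem wLawAt_two_iff_six_le (B : ℕ) : WLawAt 2 B ↔ 6 ≤ B := by
  constructor
  · intro h
    by_contra hB
    exact not_wLawAt_two_five (wLawAt_mono h (by omega))
  · intro hB
    exact wLawAt_mono wLawAt_two_six hB

/-- **`WLaw` holds at `n = 2`** (`WLawAt 2 (3·2)`). [folklore] -/
theorem wLaw_two : WLawAt 2 (3 * 2) := wLawAt_two_six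

end Summit.ValiantsHypothesis.ValiantsHypothesis.Theorems.LacunarySymmetroidMatrixDescartes
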